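import Literature.Computability.Complexity.IWAmplification
import HarnessLib

/-!
# Hirahara's reduction: amplification data and coins

Topic `Computability/Complexity`. The per-variable data of Hirahara's reduction from CMMSA to
`MCSP*` (ECCC TR22-119, proof of Lemma 8.3): each variable `k < n` gets a uniformly random function
`f_k : {0,1}^{N_k} → {0,1}` (the coins of the reduction), amplified by the derandomized XOR lemma
(`IWAmp.amp` with a design `eA k` and Hankel indices `idxA k`) and read off NW blocks of a common
length `ℓ` through an explicit identification `Φ_k : Seed × Suf_k ≃ {0,1}^ℓ` (the printed "the last
`ℓ − cn` bits are ignored"). This file only holds the data (`HiraharaRed.AmpData`), the coin space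
(`HiraharaRed.Coins`) and the padded amplified functions (`HiraharaRed.fhat`, `HiraharaRed.Fhat`)
shared by the completeness and soundness files.

## References

* S. Hirahara, *NP-hardness of learning programs and partial MCSP*, ECCC TR22-119, proof of
  Lemma 8.3 (p. 28: "f̂ᵢ := Amp^{fᵢ}", "pick fᵢ ∼ {0,1}^{λ w(i)}") [Hirahara2022PartialMCSP].
-/

namespace Literature.Computability.Complexity

namespace HiraharaRed

variable {n ℓ kA : ℕ}

/-- **Amplification data of the variables**: arity `N_k`, Nisan–Wigderson design and Hankel index of
`Amp`, a padding type `Suf_k` and the explicit identification `Seed × Suf_k ≃ {0,1}^ℓ` by which the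
common-length NW blocks are read. [cite: Hirahara2022PartialMCSP, proof of Lemma 8.3 ("f̂ᵢ := Amp^{fᵢ} … the last ℓ − cn bits are ignored")] -/
structure AmpData (n ℓ kA : ℕ) where
  /-- arity of `f_k` -/
  N : Fin n → ℕ
  /-- universe of the amplification design -/
  dA : Fin n → ℕ
  /-- Hankel seed parameter -/
  mI : Fin n → ℕ
  /-- the amplification design -/
  eA : (k : Fin n) → Fin kA → (Fin (N k) ↪ Fin (dA k))
  /-- the Hankel index vectors -/
  idxA : (k : Fin n) → Fin kA → Fin (mI k) → ZMod 2
  /-- the padding -/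
  Suf : Fin n → Type
  [sufFintype : ∀ k, Fintype (Suf k)]
  [sufNonempty : ∀ k, Nonempty (Suf k)]
  /-- reading a block as (seed, padding) -/
  Φ : (k : Fin n) → IWAmp.Seed (N k) (dA k) (mI k) × Suf k ≃ (Fin ℓ → Bool)

variable (A : AmpData n ℓ kA)

/-- The paddings are finite types. [folklore] -/
instance instFintypeSuf (k : Fin n) : Fintype (A.Suf k) := A.sufFintype k

/-- The paddings are nonempty. [folklore] -/
instance instNonemptySuf (k : Fin n) : Nonempty (A.Suf k) := A.sufNonempty k

/-- The coin space: one Boolean function of arity `N_k` per variable. [cite: Hirahara2022PartialMCSP, proof of Lemma 8.3 ("pick fᵢ ∼ {0,1}^{λ w(i)}")] -/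
abbrev Coins : Type := (k : Fin n) → ((Fin (A.N k) → Bool) → Bool)

/-- The padded amplified function `f̂_k(y) = Amp^{f}((Φ_k⁻¹ y).1)` of one variable. [cite: Hirahara2022PartialMCSP, proof of Lemma 8.3 (f̂ᵢ := Amp^{fᵢ})] -/
def fhat (k : Fin n) (f : (Fin (A.N k) → Bool) → Bool) : (Fin ℓ → Bool) → Bool :=
  fun y => IWAmp.amp (A.eA k) (A.idxA k) f ((A.Φ k).symm y).1

/-- All padded amplified functions of a coin tuple. [cite: Hirahara2022PartialMCSP, proof of Lemma 8.3] -/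
def Fhat (F : Coins A) : Fin n → (Fin ℓ → Bool) → Bool := fun k => fhat A k (F k)

/-- Unfolding `Fhat`. [folklore] -/
@[simp] theorem Fhat_apply (F : Coins A) (k : Fin n) : Fhat A F k = fhat A k (F k) := rfl

end HiraharaRed

end Literature.Computability.Complexity
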